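import Summits.QuantumFields.YangMills.Theorems.BalabanUVNodesN22KernelFadingAgeWeighted

/-!
# BalabanUVNodes ∕ node N22 = NE9 — THE AGE-WEIGHTED EDITIONS AT THE RECORD: K3's `h9` WITH THE RECORD's GEOMETRIC MODULI from node N18's kernel step rate + a TERM-LEVEL
# second-difference letter ∕ the SECTOR datum whose constants GROW GEOMETRICALLY IN THE AGE of the young coordinate (ratio `q ≥ 1`) + the printed output bound, under the
# row `ℓ.θ₅·q ≤ ℓ.ω²` — J46 §1–§4 with ROAD 2's full window (J46 is `q = 1`)

Cell `pub-ymgap`, HUMAN RULING D-0062 (Track A), R134 seat `pub-ymgap-dag-n22-c` (strategy s1), generation 16, module J49.  THEOREMS ONLY (no `def`, no `sorry`, standard axioms);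
`--kind proof --supports stmt-QuantumFields-27366 --as helper` (K3⁸ `SpineGivenEndpointR13SepCoPHV`, skeleton v6 — §2b N22 face `h9` verbatim), COUNT-NEUTRAL.  Imports module J48
`…N22KernelFadingAgeWeighted` (`kernelSecondDiff_objectsOfRecord₁₃_of_termSecondDiffAt`, `ne9_EA_objectsOfRecord₁₃_of_kernelStepRate_secondDiffGrowing`; through it J45 ∕ J46 and
dag-n22-w3's `…N22AtU3OfKernels`).  Nothing re-declared; every step is plain application — J46's four proofs with the growth ratio threaded through.

WHY (module J48's header, LOCATED on dag-n22-a's `…N22KnitDiscrete` ∕ `…N22KnitRecursion` and dag-n22-w1's `…N22KnitRoadRatesSharp`).  ROAD 2 converts node N18's oscillation fading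
(rate `θ₅`) + second differences in each young coupling into `NE9` with geometric moduli at every rate `≥ √(θ₅·μ)`, where `μ` is the AGE-GROWTH ratio of the second-difference constants;
the recursion-level producer shape for the older coordinates (`N22KnitRecursion.secondDiff_of_stepSecondDiff`) yields constants growing like `ν^{age}` with NO smallness, and
age-uniform ones only under ROAD 1's clause `ω₁ + c < 1`.  J46 pinned `μ = 1`.  THIS FILE is J46 at a general ratio `q ≥ 1`: the term-level letter reads
`‖E(g∣g_i:=t+d) − 2E(g∣g_i:=t) + E(g∣g_i:=t−d)‖ ≤ M₂·q^{k−i}·e^{−κ_E d}·d²`, the sector datum's centred quadratic bound reads `‖Ec z − V‖ ≤ B″·q^{k−i}·e^{−κ_E d}·s²`, the letter row reads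
`ℓ.θ₅·q ≤ ℓ.ω²`; everything else — N18's letter, the output bound, term holomorphy through the readings, chart ∕ space clauses, tails, W1-20's law, (1.21), the `C₉` row — VERBATIM.
* §1 ★★★ `ne9_EA_objectsOfRecord₁₃_of_kernelStepRate_termSecondDiffGrowing` — J46 §1 with the growing letter (`DecayBound` displayed).
* §2 ★★★ `…_termSecondDiffGrowing_outputBound` — §1 with `DecayBound` DISCHARGED from the printed-type OUTPUT bound (1.18) (J41 §1b + W1-21's transfer + node N18's junction).
* §3 ★★★ `…_of_kernelStepRate_sectorHoloGrowing` — THE SECTOR EDITION with growing constants: relative discs `closedBall s (c·s)`, `s ∈ ]0, θ.γ]`, centred quadratic bound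
  `B″·q^{k−i}·e^{−κ_E d}·s²` (J45 §1 ⟹ the letter with `M₂ = (6c² + 32c + 64)∕c²·B″`), then §2.  NO disc through zero coupling; NO `EHoloAt`; NO age-uniform constant.
* §4 ★★★ the pin face `n22At_rateCarriers_of_kernels_pin_of_kernelStepRate_sectorHoloGrowing` (every `k`, under `hpin`).
DISPLAYED INPUTS by owner: as in J46 (N18's `KernelStepRateOfRecord₁₃`: node N18, NE5 NOT PRINTED for d = 4; the letter ∕ sector table: N09 for the last coupling, N10 ∕ NODE A ∕ def-W1's
generator for the older ones — the cell's quantitative reading of [I] p. 263 «C^∞ … (or analytic)», (2.12)–(2.13) p. 268 «vanishes at g_k = 0» under possibility 1, NOTHING quantitative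
being printed for the older couplings; the output bound: printed TYPE (1.18), N10 ∕ NODE A at the towers of record; readings ∕ tails: NODE A ∕ N09; law: NODE A ∕ def-W1; (1.21):
dag-n22-w3's road; rows jointly satisfiable with `ℓ.Signs` whenever `θ₅q < 1`).

HONEST FRAMING (binding).  Count-neutral COMPOSITION; NO estimate of Bałaban's is proved or asserted; nothing of the record is constructed or claimed to meet the displayed inputs;
N22 is NOT discharged (typed 28∕28 · discharged 5∕27 UNCHANGED); K3⁸ OPEN and NOT claimed (no stub of 27366 touched); NE9 is NOT IN PRINT for d = 4; no count claim; one finite 𝕋⁴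
programme at fixed ε — R4 closes the CONDITIONAL rung `BalabanLadder.UV` only; NOTHING about the continuum limit, ℝ⁴, infinite volume, OS axioms, a mass gap or the Clay problem
is proved or claimed.  References (TYPES only, no cite tags on the Summit side): [I] = Bałaban, CMP 109 (1987) Thm 1 p. 259, (1.7) p. 261, §1 p. 263 with (1.18), (1.20)–(1.22)
p. 264, (2.9) p. 266, (2.12)–(2.13) p. 268, p. 282 (site-weight tails: the sentence after (4.4)), (4.35)–(4.37) pp. 290–291, (5.10) p. 293; [II] = CMP 116 (1988) (2.3) p. 12,
(2.13)–(2.14) pp. 14–15; King, CMP 102 (1986) Lemma 4.5 (the N18 mechanism's print).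
-/

noncomputable section

open Filter Topology Set Metric
open scoped BigOperators

namespace YMDAG.N22.KernelFading

open Literature.MathematicalPhysics.QuantumFieldTheory.Balaban1983to89
open Literature.MathematicalPhysics.QuantumFieldTheory.Balaban1983to89.T4Continuum (T4Family ULoop)
open Literature.MathematicalPhysics.QuantumFieldTheory.Balaban1983to89.T4OutputRate (Carriers Functional Window NE9 DecayBound)
open Literature.MathematicalPhysics.QuantumFieldTheory.Balaban1983to89.TreeLengthTorus (TPt)
open Literature.MathematicalPhysics.QuantumFieldTheory.Balaban1983to89.B12TreeDecay (K₀ kappa₀ K₀_pos)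
open Literature.MathematicalPhysics.QuantumFieldTheory.Balaban1983to89.B12Decay510 (delta1)
open Literature.MathematicalPhysics.QuantumFieldTheory.Balaban1983to89.B12Decay510Window (K₁ K₁_nonneg)
open Literature.MathematicalPhysics.QuantumFieldTheory.Balaban1983to89.B12Decay510Torus (distCT nearT)
open Literature.MathematicalPhysics.QuantumFieldTheory.Balaban1983to89.B12Sec2to5 (l1)
open Literature.MathematicalPhysics.QuantumFieldTheory.Balaban1983to89.Node00 (Stage13Params Stage13HParams U3Letters₁₁ MatA)
open Literature.MathematicalPhysics.QuantumFieldTheory.Balaban1983to89.Node00.Sect2 (domSys domCount CPair)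
open Literature.MathematicalPhysics.QuantumFieldTheory.Balaban1983to89.Node00.W1
open Literature.MathematicalPhysics.QuantumFieldTheory.Balaban1983to89.Node00.LocalizedSum17 (localizedSum ReadingMaps Localizes17OfRecord₁₃)
open Literature.MathematicalPhysics.QuantumFieldTheory.Balaban1983to89.Node00.U3OfKernels (histPrefix objectsOfRecord₁₃)
open Literature.MathematicalPhysics.QuantumFieldTheory.Balaban1983to89.Node00.U3KernelLetters (KernelStepRateOfRecord₁₃ PolLimitsExistOfRecord₁₃)
open Literature.MathematicalPhysics.QuantumFieldTheory.Balaban1983to89.Node00.U3KernelLetters2 (windowedDecayUniformOfRecord₁₃_iff_of_localizes)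
open YMDAG.N22.UniformDecay (windowedDecayUniform_localizedSum_of_outputBound)
open YMDAG.N18.KernelLettersJunctions (decayBound_EA_of_windowedDecayUniform)
open Summit.QuantumFields.YangMills.BalabanUVNodes.N18KingModelOneRun (decayBound_mono)
open YMDAG.N18.KernelStepRateKingMechanism (kernelStepRate_mono)
open YMDAG.UVSplit (N22At RateReading₁₃CoPH rateCarriersOfRecord₁₃CoPH)
open YMDAG.N22.AtKernels (n22At_rateCarriers_of_kernels_pin_of_ne9)

open scoped Matrix.Norms.L2Operator

variable (F : T4Family) (N : ℕ) [NeZero N] {𝔸 : Type*} {M : ℕ}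

/-! ## §1 K3's `h9` from node N18's kernel step rate + a term-level second-difference letter GROWING in the age (J46 §1 at ratio `q`) -/

open Classical in
/-- ★★★ **«J38 AT THE RECORD» ON THE HONEST INTERFACE, AGE-WEIGHTED.**  At a Stage-13 tuple `θ` (`0 < θ.γ`) with a letter block `ℓ` (`ℓ.Signs`): node N18's
`KernelStepRateOfRecord₁₃ F N θ κ₅ ℓ.θ₅ C₅`; the uniform kernel decay `DecayBound ((objectsOfRecord₁₃ F N θ ℓ).EA 0) (Window θ.γ) E₀ κ_d` (displayed; §2 discharges it); the TERM-LEVEL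
SECOND-DIFFERENCE LETTER WITH AGE-GROWTH `q ≥ 1`: `‖E(X; g∣g_i:=t+d) − 2E(X; g∣g_i:=t) + E(X; g∣g_i:=t−d)‖ ≤ M₂·q^{k−i}·e^{−κ_E d_{k+1}(X)}·d²` on the space tables (every torus, level `k`,
young coordinate `i ≤ k`, box history, step); term holomorphy through the complexified readings of record, chart∕space clauses, site-weight tails, W1-20's law, (1.21); the rows
`δ₁ ≤ κ₅`, `δ₁ ≤ κ_d`, `0 < ℓ.ω`, **`ℓ.θ₅·q ≤ ℓ.ω²`**, `ℓ.κ ≤ δ₁`, `(4·(2C₅∕(1−ℓ.θ₅) + 2E₀)∕θ.γ + C₂·θ.γ∕2)∕ℓ.ω ≤ ℓ.C₉` with `C₂ = (16M₂B₃²∕r²)·e^{12Mδ₁}K₀K₁` ⟹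
**`NE9 ((objectsOfRecord₁₃ F N θ ℓ).EA 0) (Window θ.γ) ℓ.κ ℓ.moduli`** — module J48 §2 (table `M₂·q^{k−i}`) into J48 §4 (rates lowered to `δ₁`).  `q = 1` is J46 §1.
LOCATED (hypothesis form); N22 NOT discharged. [folklore] -/
theorem ne9_EA_objectsOfRecord₁₃_of_kernelStepRate_termSecondDiffGrowing (θ : Stage13Params F N) (ℓ : U3Letters₁₁) (hs : ℓ.Signs) (hγ : 0 < θ.γ)
    (hlim : PolLimitsExistOfRecord₁₃ F N θ) {κ₅ κd C₅ E₀ : ℝ} (hC₅ : 0 ≤ C₅) (hE₀ : 0 ≤ E₀)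
    (h5 : KernelStepRateOfRecord₁₃ F N θ κ₅ ℓ.θ₅ C₅) (hdec : DecayBound ((objectsOfRecord₁₃ F N θ ℓ).EA 0) (Window θ.γ) E₀ κd)
    (m' : ℕ) (M : ℕ) [NeZero M] (hM : M = F.L ^ m')
    (S : (K : ℕ) → ClusterTower (F.P K) 𝔸 M) (emb : ReadingMaps F (MatA N) 𝔸) (hloc : Localizes17OfRecord₁₃ F N θ S emb)
    (sp : (K k : ℕ) → (domSys (F.P K) M (k + 1)).Dom → Set (CPair (F.P K) 𝔸))
    {κ κE δ₀ B₃ r M₂ q : ℝ}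
    (hκ₀ : kappa₀ (4 * 2 ^ 4) (2 * 4) ≤ κ / 2) (hδ₀ : 0 < δ₀) (hB₃ : 0 ≤ B₃) (hr : 0 < r) (hM₂ : 0 ≤ M₂) (hq : 1 ≤ q) (hκE : κ ≤ κE)
    (hΔ : ∀ (K k : ℕ) (i : Fin (k + 1)), ∀ g ∈ box θ.γ k, ∀ (X : (domSys (F.P K) M (k + 1)).Dom), ∀ φ ∈ sp K k X, ∀ t d : ℝ, 0 < d →
      t - d ∈ Ioc (0 : ℝ) θ.γ → t + d ∈ Ioc (0 : ℝ) θ.γ →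
        ‖((S K) k).E (Function.update g i (t + d)) φ X - 2 * ((S K) k).E (Function.update g i t) φ X + ((S K) k).E (Function.update g i (t - d)) φ X‖ ≤
          M₂ * q ^ (k - (i : ℕ)) * Real.exp (-(κE * (domSys (F.P K) M (k + 1)).dj X)) * d ^ 2)
    (Ec : ℕ → ℕ → Type*) [∀ K k, NormedAddCommGroup (Ec K k)] [∀ K k, NormedSpace ℂ (Ec K k)]
    (ι : letI := θ.instVβ₁; letI := θ.instVβ₂
      (K k : ℕ) → (domSys (F.P K) M (k + 1)).Dom → ((Fin (F.P K).d → Site (F.P K) (k + 1) → θ.Vβ) →L[ℝ] Ec K k))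
    (Φ : (K k : ℕ) → (domSys (F.P K) M (k + 1)).Dom → Ec K k → CPair (F.P K) 𝔸)
    (U : (K k : ℕ) → (domSys (F.P K) M (k + 1)).Dom → Set (Ec K k)) (hU : ∀ K k X, IsOpen (U K k X)) (hrU : ∀ K k X, ball (0 : Ec K k) r ⊆ U K k X)
    (hEhol : ∀ g ∈ Window θ.γ, ∀ (K k : ℕ) (X : (domSys (F.P K) M (k + 1)).Dom),
      DifferentiableOn ℂ (fun z => ((S K) k).E (histPrefix g k) (Φ K k X z) X) (U K k X))
    (hΦemb : letI := θ.instVβ₁; letI := θ.instVβ₂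
      ∀ (K k : ℕ) (X : (domSys (F.P K) M (k + 1)).Dom) (Bf : Fin (F.P K).d → Site (F.P K) (k + 1) → θ.Vβ),
        Φ K k X (ι K k X Bf) = emb K k (fun l t => NormedSpace.exp (θ.ρ8 (Bf l t))))
    (hΦsp : ∀ (K k : ℕ) (X : (domSys (F.P K) M (k + 1)).Dom), ∀ z ∈ ball (0 : Ec K k) r, Φ K k X z ∈ sp K k X)
    (w : (K k : ℕ) → (domSys (F.P K) M (k + 1)).Dom → Site (F.P K) (k + 1) → ℝ) (hw₀ : ∀ K k X t, 0 ≤ w K k X t)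
    (hw : letI := θ.instVβ₁; letI := θ.instVβ₂; letI := θ.instιβ
      ∀ (K k : ℕ) (X : (domSys (F.P K) M (k + 1)).Dom) (l : Fin (F.P K).d) (t : Site (F.P K) (k + 1)) (c : θ.ιβ),
        ‖ι K k X (Pi.single l (Pi.single t (θ.bV c)))‖ ≤ w K k X t)
    (htail : ∀ (K k : ℕ) (X : (domSys (F.P K) M (k + 1)).Dom) (t : Site (F.P K) (k + 1)),
      let e : Site (F.P K) (k + 1) → TPt 4 (domCount (F.P K) M (k + 1) * M) := fun x i => (ZMod.cast (x i) : ZMod (domCount (F.P K) M (k + 1) * M))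
      w K k X t ≤ B₃ * Real.exp (-δ₀ * distCT (domCount (F.P K) M (k + 1)) M (e t) (nearT (M := M) (e t) X)))
    (hκ₅ : delta1 δ₀ κ ((M : ℝ) * 4) ≤ κ₅) (hκd : delta1 δ₀ κ ((M : ℝ) * 4) ≤ κd)
    (hω : 0 < ℓ.ω) (hθω : ℓ.θ₅ * q ≤ ℓ.ω ^ 2) (hℓκ : ℓ.κ ≤ delta1 δ₀ κ ((M : ℝ) * 4))
    (hC₉ : (4 * (2 * C₅ / (1 - ℓ.θ₅) + 2 * E₀) / θ.γ +
        ((16 * M₂ * B₃ ^ 2 / r ^ 2) * Real.exp (delta1 δ₀ κ ((M : ℝ) * 4) * ((M : ℝ) * 4) * 3) * K₀ (4 * 2 ^ 4) (2 * 4) *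
          K₁ 4 (δ₀ / 2)) * θ.γ / 2) / ℓ.ω ≤ ℓ.C₉) :
    NE9 ((objectsOfRecord₁₃ F N θ ℓ).EA 0) (Window θ.γ) ℓ.κ ℓ.moduli := by
  have hK : 0 < K₀ (4 * 2 ^ 4) (2 * 4) := K₀_pos _ _
  have hq0 : 0 ≤ q := zero_le_one.trans hq
  have hC₂ : (0 : ℝ) ≤ ((16 * M₂ * B₃ ^ 2 / r ^ 2) * Real.exp (delta1 δ₀ κ ((M : ℝ) * 4) * ((M : ℝ) * 4) * 3) * K₀ (4 * 2 ^ 4) (2 * 4) *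
          K₁ 4 (δ₀ / 2)) := by
    have := K₁_nonneg 4 (δ₀ / 2); positivity
  have h5' : KernelStepRateOfRecord₁₃ F N θ (delta1 δ₀ κ ((M : ℝ) * 4)) ℓ.θ₅ C₅ := by
    letI := θ.instVβ₁; letI := θ.instVβ₂; letI := θ.instιβ
    exact kernelStepRate_mono F θ.ρ8 θ.bV h5 le_rfl hκ₅ hs.θ₅_pos.le le_rfl le_rfl hC₅
  -- module J48 §2 at the table `M₂·q^{k−i}`
  have hM₂t : ∀ k i : ℕ, 0 ≤ M₂ * q ^ (k - i) := fun k i => by positivity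
  have hK2 := kernelSecondDiff_objectsOfRecord₁₃_of_termSecondDiffAt F N θ ℓ hlim m' M hM S emb hloc sp (M₂ := fun k i => M₂ * q ^ (k - i)) hκ₀ hδ₀ hB₃ hr hM₂t hκE
    hΔ Ec ι Φ U hU hrU hEhol hΦemb hΦsp w hw₀ hw htail
  -- reshuffle the constant: `16·(M₂q^{a})·B₃²∕r²·… = C₂·q^{a}·…`
  have hR2 : ∀ g ∈ Window θ.γ, ∀ (Uu : PUnit) (X : ((objectsOfRecord₁₃ F N θ ℓ).levelCarriers 0).Dom) (i : ℕ),
      i < ((objectsOfRecord₁₃ F N θ ℓ).levelCarriers 0).scale X → ∀ t d : ℝ, 0 < d → t - d ∈ Ioc (0 : ℝ) θ.γ → t + d ∈ Ioc (0 : ℝ) θ.γ →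
        |(objectsOfRecord₁₃ F N θ ℓ).EA 0 (Function.update g i (t + d)) Uu X - 2 * (objectsOfRecord₁₃ F N θ ℓ).EA 0 (Function.update g i t) Uu X +
            (objectsOfRecord₁₃ F N θ ℓ).EA 0 (Function.update g i (t - d)) Uu X| ≤
          ((16 * M₂ * B₃ ^ 2 / r ^ 2) * Real.exp (delta1 δ₀ κ ((M : ℝ) * 4) * ((M : ℝ) * 4) * 3) * K₀ (4 * 2 ^ 4) (2 * 4) * K₁ 4 (δ₀ / 2)) *
            q ^ (((objectsOfRecord₁₃ F N θ ℓ).levelCarriers 0).scale X - 1 - i) *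
            Real.exp (-(delta1 δ₀ κ ((M : ℝ) * 4) * ((objectsOfRecord₁₃ F N θ ℓ).levelCarriers 0).d X)) * d ^ 2 := by
    intro g hg Uu X i hi t d hd hm hp
    refine (hK2 g hg Uu X i hi t d hd hm hp).trans (le_of_eq ?_)
    ring
  exact ne9_EA_objectsOfRecord₁₃_of_kernelStepRate_secondDiffGrowing F N θ ℓ hs hγ hC₅ hE₀ hC₂ hq h5' (decayBound_mono hdec subset_rfl hκd le_rfl) hR2 hω hθω hℓκ hC₉

/-! ## §2 … with the uniform decay DISCHARGED from a PRINTED-type output bound (J46 §2 at ratio `q`) -/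

open Classical in
/-- ★★★ **THE SAME WITH `DecayBound` DISCHARGED FROM AN OUTPUT BOUND.**  §1's inputs minus `hdec`, plus the printed-type OUTPUT bound `hbd : ‖E^{(k+1)}(X; g; φ)‖ ≤ B·e^{−κ_E d_{k+1}(X)}`
on the space tables at every window history ([I] (1.18) p. 263, node N10 ∕ NODE A) ⟹ `h9` with `E₀ := E₁ = (16BB₃²∕r²)·e^{12Mδ₁}K₀K₁` and `κ_d := δ₁` — J41 §1b + W1-21's
`windowedDecayUniformOfRecord₁₃_iff_of_localizes` + node N18's `decayBound_EA_of_windowedDecayUniform`, then §1.  `q = 1` is J46 §2.  LOCATED (hypothesis form); N22 NOT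
discharged. [folklore] -/
theorem ne9_EA_objectsOfRecord₁₃_of_kernelStepRate_termSecondDiffGrowing_outputBound (θ : Stage13Params F N) (ℓ : U3Letters₁₁) (hs : ℓ.Signs) (hγ : 0 < θ.γ)
    (hlim : PolLimitsExistOfRecord₁₃ F N θ) {κ₅ C₅ : ℝ} (hC₅ : 0 ≤ C₅) (h5 : KernelStepRateOfRecord₁₃ F N θ κ₅ ℓ.θ₅ C₅)
    (m' : ℕ) (M : ℕ) [NeZero M] (hM : M = F.L ^ m')
    (S : (K : ℕ) → ClusterTower (F.P K) 𝔸 M) (emb : ReadingMaps F (MatA N) 𝔸) (hloc : Localizes17OfRecord₁₃ F N θ S emb)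
    (sp : (K k : ℕ) → (domSys (F.P K) M (k + 1)).Dom → Set (CPair (F.P K) 𝔸))
    {κ κE δ₀ B₃ r M₂ q B : ℝ}
    (hκ₀ : kappa₀ (4 * 2 ^ 4) (2 * 4) ≤ κ / 2) (hδ₀ : 0 < δ₀) (hB₃ : 0 ≤ B₃) (hr : 0 < r) (hM₂ : 0 ≤ M₂) (hq : 1 ≤ q) (hB : 0 ≤ B) (hκE : κ ≤ κE)
    (hΔ : ∀ (K k : ℕ) (i : Fin (k + 1)), ∀ g ∈ box θ.γ k, ∀ (X : (domSys (F.P K) M (k + 1)).Dom), ∀ φ ∈ sp K k X, ∀ t d : ℝ, 0 < d →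
      t - d ∈ Ioc (0 : ℝ) θ.γ → t + d ∈ Ioc (0 : ℝ) θ.γ →
        ‖((S K) k).E (Function.update g i (t + d)) φ X - 2 * ((S K) k).E (Function.update g i t) φ X + ((S K) k).E (Function.update g i (t - d)) φ X‖ ≤
          M₂ * q ^ (k - (i : ℕ)) * Real.exp (-(κE * (domSys (F.P K) M (k + 1)).dj X)) * d ^ 2)
    (hbd : ∀ g ∈ Window θ.γ, ∀ (K k : ℕ) (X : (domSys (F.P K) M (k + 1)).Dom), ∀ φ ∈ sp K k X,
      ‖((S K) k).E (histPrefix g k) φ X‖ ≤ B * Real.exp (-(κE * (domSys (F.P K) M (k + 1)).dj X)))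
    (Ec : ℕ → ℕ → Type*) [∀ K k, NormedAddCommGroup (Ec K k)] [∀ K k, NormedSpace ℂ (Ec K k)]
    (ι : letI := θ.instVβ₁; letI := θ.instVβ₂
      (K k : ℕ) → (domSys (F.P K) M (k + 1)).Dom → ((Fin (F.P K).d → Site (F.P K) (k + 1) → θ.Vβ) →L[ℝ] Ec K k))
    (Φ : (K k : ℕ) → (domSys (F.P K) M (k + 1)).Dom → Ec K k → CPair (F.P K) 𝔸)
    (U : (K k : ℕ) → (domSys (F.P K) M (k + 1)).Dom → Set (Ec K k)) (hU : ∀ K k X, IsOpen (U K k X)) (hrU : ∀ K k X, ball (0 : Ec K k) r ⊆ U K k X)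
    (hEhol : ∀ g ∈ Window θ.γ, ∀ (K k : ℕ) (X : (domSys (F.P K) M (k + 1)).Dom),
      DifferentiableOn ℂ (fun z => ((S K) k).E (histPrefix g k) (Φ K k X z) X) (U K k X))
    (hΦemb : letI := θ.instVβ₁; letI := θ.instVβ₂
      ∀ (K k : ℕ) (X : (domSys (F.P K) M (k + 1)).Dom) (Bf : Fin (F.P K).d → Site (F.P K) (k + 1) → θ.Vβ),
        Φ K k X (ι K k X Bf) = emb K k (fun l t => NormedSpace.exp (θ.ρ8 (Bf l t))))
    (hΦsp : ∀ (K k : ℕ) (X : (domSys (F.P K) M (k + 1)).Dom), ∀ z ∈ ball (0 : Ec K k) r, Φ K k X z ∈ sp K k X)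
    (w : (K k : ℕ) → (domSys (F.P K) M (k + 1)).Dom → Site (F.P K) (k + 1) → ℝ) (hw₀ : ∀ K k X t, 0 ≤ w K k X t)
    (hw : letI := θ.instVβ₁; letI := θ.instVβ₂; letI := θ.instιβ
      ∀ (K k : ℕ) (X : (domSys (F.P K) M (k + 1)).Dom) (l : Fin (F.P K).d) (t : Site (F.P K) (k + 1)) (c : θ.ιβ),
        ‖ι K k X (Pi.single l (Pi.single t (θ.bV c)))‖ ≤ w K k X t)
    (htail : ∀ (K k : ℕ) (X : (domSys (F.P K) M (k + 1)).Dom) (t : Site (F.P K) (k + 1)),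
      let e : Site (F.P K) (k + 1) → TPt 4 (domCount (F.P K) M (k + 1) * M) := fun x i => (ZMod.cast (x i) : ZMod (domCount (F.P K) M (k + 1) * M))
      w K k X t ≤ B₃ * Real.exp (-δ₀ * distCT (domCount (F.P K) M (k + 1)) M (e t) (nearT (M := M) (e t) X)))
    (hκ₅ : delta1 δ₀ κ ((M : ℝ) * 4) ≤ κ₅)
    (hω : 0 < ℓ.ω) (hθω : ℓ.θ₅ * q ≤ ℓ.ω ^ 2) (hℓκ : ℓ.κ ≤ delta1 δ₀ κ ((M : ℝ) * 4))
    (hC₉ : (4 * (2 * C₅ / (1 - ℓ.θ₅) + 2 * ((16 * B * B₃ ^ 2 / r ^ 2) * Real.exp (delta1 δ₀ κ ((M : ℝ) * 4) * ((M : ℝ) * 4) * 3) * K₀ (4 * 2 ^ 4) (2 * 4) * K₁ 4 (δ₀ / 2))) / θ.γ +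
        ((16 * M₂ * B₃ ^ 2 / r ^ 2) * Real.exp (delta1 δ₀ κ ((M : ℝ) * 4) * ((M : ℝ) * 4) * 3) * K₀ (4 * 2 ^ 4) (2 * 4) *
          K₁ 4 (δ₀ / 2)) * θ.γ / 2) / ℓ.ω ≤ ℓ.C₉) :
    NE9 ((objectsOfRecord₁₃ F N θ ℓ).EA 0) (Window θ.γ) ℓ.κ ℓ.moduli := by
  letI := θ.instVβ₁; letI := θ.instVβ₂; letI := θ.instιβ
  have hK : 0 < K₀ (4 * 2 ^ 4) (2 * 4) := K₀_pos _ _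
  have hE₁ : (0 : ℝ) ≤ ((16 * B * B₃ ^ 2 / r ^ 2) * Real.exp (delta1 δ₀ κ ((M : ℝ) * 4) * ((M : ℝ) * 4) * 3) * K₀ (4 * 2 ^ 4) (2 * 4) * K₁ 4 (δ₀ / 2)) := by
    have := K₁_nonneg 4 (δ₀ / 2); positivity
  -- the uniform decay of record from the output bound (J41 §1b, W1-21's transfer, node N18's junction)
  have hUn := windowedDecayUniform_localizedSum_of_outputBound F m' M hM S emb θ.ρ8 θ.bV sp hκ₀ hδ₀ hB₃ hr hB hκE hbd Ec ι Φ U hU hrU hEhol hΦemb hΦsp w hw₀ hw htail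
  have hRec := (windowedDecayUniformOfRecord₁₃_iff_of_localizes F N θ S emb hloc _ _).2 hUn
  have hdec : DecayBound ((objectsOfRecord₁₃ F N θ ℓ).EA 0) (Window θ.γ) ((16 * B * B₃ ^ 2 / r ^ 2) * Real.exp (delta1 δ₀ κ ((M : ℝ) * 4) * ((M : ℝ) * 4) * 3) * K₀ (4 * 2 ^ 4) (2 * 4) * K₁ 4 (δ₀ / 2)) (delta1 δ₀ κ ((M : ℝ) * 4)) :=
    decayBound_EA_of_windowedDecayUniform F _ θ.ρ8 θ.bV hlim hRec
  exact ne9_EA_objectsOfRecord₁₃_of_kernelStepRate_termSecondDiffGrowing F N θ ℓ hs hγ hlim hC₅ hE₁ h5 hdec m' M hM S emb hloc sp hκ₀ hδ₀ hB₃ hr hM₂ hq hκE hΔ Ec ι Φ U hU hrU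
    hEhol hΦemb hΦsp w hw₀ hw htail hκ₅ le_rfl hω hθω hℓκ hC₉

/-! ## §3 ★★★ THE SECTOR EDITION WITH AGE-GROWING CONSTANTS (possibility 1; J46 §3 at ratio `q`) -/

open Classical in
/-- ★★★ **K3's `h9` WITH THE RECORD's GEOMETRIC MODULI FROM NODE N18's KERNEL STEP RATE + THE possibility-1 COUPLING DATUM WHOSE CONSTANTS GROW GEOMETRICALLY IN THE AGE.**  At a
Stage-13 tuple `θ` with a letter block `ℓ`: node N18's `KernelStepRateOfRecord₁₃ F N θ κ₅ ℓ.θ₅ C₅`; towers `S K` read through `emb` with W1-20's law; THE AGE-WEIGHTED SECTOR DATUM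
`hLsec`: for every torus, level `k`, young coordinate `i ≤ k`, box history `g`, domain `X` and admissible `φ`, the (2.13) term `t ↦ E^{(k+1)}(X; g∣g_i := t; φ)` extends to `Ec`
holomorphic on a set containing the RELATIVE closed discs `closedBall s (c·s)`, `s ∈ ]0, θ.γ]` (no disc meets `g_i = 0`), with the CENTRED QUADRATIC bound
`‖Ec z − V‖ ≤ B″·q^{k−i}·e^{−κ_E d_{k+1}(X)}·s²` for a `z`-independent value `V` — the constant may GROW like `q^{k−i}` in the age of the coordinate (`q ≥ 1`; for the older coordinates
the chart born at the coordinate's creation step and propagated through the generator, whose recursion-level producer shape delivers exactly such growth); the printed-type OUTPUT bound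
`hbd` ([I] (1.18)); term holomorphy through the readings, chart∕space clauses, tails; (1.21); the rows of §2 (`ℓ.θ₅·q ≤ ℓ.ω²`; `M₂ := (6c² + 32c + 64)∕c²·B″` inside `C₂`) ⟹
**`NE9 ((objectsOfRecord₁₃ F N θ ℓ).EA 0) (Window θ.γ) ℓ.κ ℓ.moduli`** — module J45 §1 `norm_secondDiff_le_of_sectorHolo` produces the growing letter coordinate by coordinate, then
§2.  NO disc through zero coupling; NO `EHoloAt`; NO age-uniform constant.  `q = 1` is J46 §3.  LOCATED (hypothesis form; the sector datum is the cell's quantitative reading, NOT a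
printed display); N22 NOT discharged. [folklore] -/
theorem ne9_EA_objectsOfRecord₁₃_of_kernelStepRate_sectorHoloGrowing (θ : Stage13Params F N) (ℓ : U3Letters₁₁) (hs : ℓ.Signs) (hγ : 0 < θ.γ)
    (hlim : PolLimitsExistOfRecord₁₃ F N θ) {κ₅ C₅ : ℝ} (hC₅ : 0 ≤ C₅) (h5 : KernelStepRateOfRecord₁₃ F N θ κ₅ ℓ.θ₅ C₅)
    (m' : ℕ) (M : ℕ) [NeZero M] (hM : M = F.L ^ m')
    (S : (K : ℕ) → ClusterTower (F.P K) 𝔸 M) (emb : ReadingMaps F (MatA N) 𝔸) (hloc : Localizes17OfRecord₁₃ F N θ S emb)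
    (sp : (K k : ℕ) → (domSys (F.P K) M (k + 1)).Dom → Set (CPair (F.P K) 𝔸))
    {κ κE δ₀ B₃ r c B'' q B : ℝ} (hc : 0 < c) (hB'' : 0 ≤ B'') (hq : 1 ≤ q)
    (hκ₀ : kappa₀ (4 * 2 ^ 4) (2 * 4) ≤ κ / 2) (hδ₀ : 0 < δ₀) (hB₃ : 0 ≤ B₃) (hr : 0 < r) (hB : 0 ≤ B) (hκE : κ ≤ κE)
    (hLsec : ∀ (K k : ℕ) (i : Fin (k + 1)), ∀ g ∈ box θ.γ k, ∀ (X : (domSys (F.P K) M (k + 1)).Dom), ∀ φ ∈ sp K k X,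
      ∃ (Ec : ℂ → ℂ) (O : Set ℂ) (Vc : ℂ), DifferentiableOn ℂ Ec O ∧ (∀ s ∈ Ioc (0 : ℝ) θ.γ, closedBall (s : ℂ) (c * s) ⊆ O) ∧
        (∀ s ∈ Ioc (0 : ℝ) θ.γ, ∀ z ∈ closedBall (s : ℂ) (c * s), ‖Ec z - Vc‖ ≤ B'' * q ^ (k - (i : ℕ)) * Real.exp (-(κE * (domSys (F.P K) M (k + 1)).dj X)) * s ^ 2) ∧
        (∀ t ∈ Ioc (0 : ℝ) θ.γ, Ec t = ((S K) k).E (Function.update g i t) φ X))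
    (hbd : ∀ g ∈ Window θ.γ, ∀ (K k : ℕ) (X : (domSys (F.P K) M (k + 1)).Dom), ∀ φ ∈ sp K k X,
      ‖((S K) k).E (histPrefix g k) φ X‖ ≤ B * Real.exp (-(κE * (domSys (F.P K) M (k + 1)).dj X)))
    (Ec : ℕ → ℕ → Type*) [∀ K k, NormedAddCommGroup (Ec K k)] [∀ K k, NormedSpace ℂ (Ec K k)]
    (ι : letI := θ.instVβ₁; letI := θ.instVβ₂
      (K k : ℕ) → (domSys (F.P K) M (k + 1)).Dom → ((Fin (F.P K).d → Site (F.P K) (k + 1) → θ.Vβ) →L[ℝ] Ec K k))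
    (Φ : (K k : ℕ) → (domSys (F.P K) M (k + 1)).Dom → Ec K k → CPair (F.P K) 𝔸)
    (U : (K k : ℕ) → (domSys (F.P K) M (k + 1)).Dom → Set (Ec K k)) (hU : ∀ K k X, IsOpen (U K k X)) (hrU : ∀ K k X, ball (0 : Ec K k) r ⊆ U K k X)
    (hEhol : ∀ g ∈ Window θ.γ, ∀ (K k : ℕ) (X : (domSys (F.P K) M (k + 1)).Dom),
      DifferentiableOn ℂ (fun z => ((S K) k).E (histPrefix g k) (Φ K k X z) X) (U K k X))
    (hΦemb : letI := θ.instVβ₁; letI := θ.instVβ₂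
      ∀ (K k : ℕ) (X : (domSys (F.P K) M (k + 1)).Dom) (Bf : Fin (F.P K).d → Site (F.P K) (k + 1) → θ.Vβ),
        Φ K k X (ι K k X Bf) = emb K k (fun l t => NormedSpace.exp (θ.ρ8 (Bf l t))))
    (hΦsp : ∀ (K k : ℕ) (X : (domSys (F.P K) M (k + 1)).Dom), ∀ z ∈ ball (0 : Ec K k) r, Φ K k X z ∈ sp K k X)
    (w : (K k : ℕ) → (domSys (F.P K) M (k + 1)).Dom → Site (F.P K) (k + 1) → ℝ) (hw₀ : ∀ K k X t, 0 ≤ w K k X t)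
    (hw : letI := θ.instVβ₁; letI := θ.instVβ₂; letI := θ.instιβ
      ∀ (K k : ℕ) (X : (domSys (F.P K) M (k + 1)).Dom) (l : Fin (F.P K).d) (t : Site (F.P K) (k + 1)) (c : θ.ιβ),
        ‖ι K k X (Pi.single l (Pi.single t (θ.bV c)))‖ ≤ w K k X t)
    (htail : ∀ (K k : ℕ) (X : (domSys (F.P K) M (k + 1)).Dom) (t : Site (F.P K) (k + 1)),
      let e : Site (F.P K) (k + 1) → TPt 4 (domCount (F.P K) M (k + 1) * M) := fun x i => (ZMod.cast (x i) : ZMod (domCount (F.P K) M (k + 1) * M))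
      w K k X t ≤ B₃ * Real.exp (-δ₀ * distCT (domCount (F.P K) M (k + 1)) M (e t) (nearT (M := M) (e t) X)))
    (hκ₅ : delta1 δ₀ κ ((M : ℝ) * 4) ≤ κ₅)
    (hω : 0 < ℓ.ω) (hθω : ℓ.θ₅ * q ≤ ℓ.ω ^ 2) (hℓκ : ℓ.κ ≤ delta1 δ₀ κ ((M : ℝ) * 4))
    (hC₉ : (4 * (2 * C₅ / (1 - ℓ.θ₅) + 2 * ((16 * B * B₃ ^ 2 / r ^ 2) * Real.exp (delta1 δ₀ κ ((M : ℝ) * 4) * ((M : ℝ) * 4) * 3) * K₀ (4 * 2 ^ 4) (2 * 4) * K₁ 4 (δ₀ / 2))) / θ.γ +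
        ((16 * ((6 * c ^ 2 + 32 * c + 64) / c ^ 2 * B'') * B₃ ^ 2 / r ^ 2) * Real.exp (delta1 δ₀ κ ((M : ℝ) * 4) * ((M : ℝ) * 4) * 3) * K₀ (4 * 2 ^ 4) (2 * 4) *
          K₁ 4 (δ₀ / 2)) * θ.γ / 2) / ℓ.ω ≤ ℓ.C₉) :
    NE9 ((objectsOfRecord₁₃ F N θ ℓ).EA 0) (Window θ.γ) ℓ.κ ℓ.moduli := by
  have hc2 : 0 < c ^ 2 := by positivity
  have hq0 : 0 ≤ q := zero_le_one.trans hq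
  have hM₂ : (0 : ℝ) ≤ (6 * c ^ 2 + 32 * c + 64) / c ^ 2 * B'' := by positivity
  -- the age-weighted term-level second-difference letter from the age-weighted sector datum (module J45 §1), coordinate by coordinate
  have hΔ : ∀ (K k : ℕ) (i : Fin (k + 1)), ∀ g ∈ box θ.γ k, ∀ (X : (domSys (F.P K) M (k + 1)).Dom), ∀ φ ∈ sp K k X, ∀ t d : ℝ, 0 < d →
      t - d ∈ Ioc (0 : ℝ) θ.γ → t + d ∈ Ioc (0 : ℝ) θ.γ →
        ‖((S K) k).E (Function.update g i (t + d)) φ X - 2 * ((S K) k).E (Function.update g i t) φ X + ((S K) k).E (Function.update g i (t - d)) φ X‖ ≤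
          (6 * c ^ 2 + 32 * c + 64) / c ^ 2 * B'' * q ^ (k - (i : ℕ)) * Real.exp (-(κE * (domSys (F.P K) M (k + 1)).dj X)) * d ^ 2 := by
    intro K k i g hg X φ hφ t d hd hm hp
    obtain ⟨Ecf, O, Vc, hhol, hball, hbq, heq⟩ := hLsec K k i g hg X φ hφ
    have ht : t ∈ Ioc (0 : ℝ) θ.γ := ⟨by linarith [hm.1], by linarith [hp.2]⟩
    have hB0 : 0 ≤ B'' * q ^ (k - (i : ℕ)) * Real.exp (-(κE * (domSys (F.P K) M (k + 1)).dj X)) := by positivity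
    have h := norm_secondDiff_le_of_sectorHolo (V := Vc) hc hB0 hhol hball hbq hd hm hp
    rw [heq _ hp, heq _ ht, heq _ hm] at h
    refine h.trans (le_of_eq ?_)
    ring
  exact ne9_EA_objectsOfRecord₁₃_of_kernelStepRate_termSecondDiffGrowing_outputBound F N θ ℓ hs hγ hlim hC₅ h5 m' M hM S emb hloc sp hκ₀ hδ₀ hB₃ hr hM₂ hq hB hκE hΔ hbd
    Ec ι Φ U hU hrU hEhol hΦemb hΦsp w hw₀ hw htail hκ₅ hω hθω hℓκ hC₉

/-! ## §4 The N22 pin face of the age-weighted sector edition -/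

open Classical in
/-- ★★★ **THE N22 PIN FACE FROM NODE N18's KERNEL STEP RATE + THE AGE-WEIGHTED SECTOR DATUM** — `N22At (rateCarriersOfRecord₁₃CoPH 𝔯 F θ hP g₀ os k).u3` for EVERY `k` under the
node-U3 pin `hpin` at the tuple (dag-n22-w3's `n22At_rateCarriers_of_kernels_pin_of_ne9` on §3 at `θ.toStage13Params`).  THE N22 ROW SENTENCE, possibility-1 currency with ROAD 2's
full window: «N18's kernel step rate + SECTOR holomorphy of the (2.13) terms in each young coupling with quadratic vanishing at zero coupling and constants growing like `q^{age}` + the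
printed output bound (1.18) + term holomorphy through the readings + p. 282 tails + W1-20's law + (1.21) + letter rows with `ℓ.θ₅·q ≤ ℓ.ω²` ⟹ §2b `h9` ∕ `N22At` WITH THE RECORD's
GEOMETRIC MODULI».  `q = 1` is J46 §4. [folklore] -/
theorem n22At_rateCarriers_of_kernels_pin_of_kernelStepRate_sectorHoloGrowing (𝔯 : RateReading₁₃CoPH N) (θ : Stage13HParams F N) (hP : θ.Provisos₁₃CoPH F N)
    (g₀ : ℕ → ℝ) (os : List (ULoop F)) (ℓ : U3Letters₁₁) (hs : ℓ.Signs) (hγ : 0 < θ.γ)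
    (hpin : (𝔯.lit F θ hP g₀ os).u3 = objectsOfRecord₁₃ F N θ.toStage13Params ℓ)
    (hlim : PolLimitsExistOfRecord₁₃ F N θ.toStage13Params) {κ₅ C₅ : ℝ} (hC₅ : 0 ≤ C₅) (h5 : KernelStepRateOfRecord₁₃ F N θ.toStage13Params κ₅ ℓ.θ₅ C₅)
    (m' : ℕ) (M : ℕ) [NeZero M] (hM : M = F.L ^ m')
    (S : (K : ℕ) → ClusterTower (F.P K) 𝔸 M) (emb : ReadingMaps F (MatA N) 𝔸) (hloc : Localizes17OfRecord₁₃ F N θ.toStage13Params S emb)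
    (sp : (K k : ℕ) → (domSys (F.P K) M (k + 1)).Dom → Set (CPair (F.P K) 𝔸))
    {κ κE δ₀ B₃ r c B'' q B : ℝ} (hc : 0 < c) (hB'' : 0 ≤ B'') (hq : 1 ≤ q)
    (hκ₀ : kappa₀ (4 * 2 ^ 4) (2 * 4) ≤ κ / 2) (hδ₀ : 0 < δ₀) (hB₃ : 0 ≤ B₃) (hr : 0 < r) (hB : 0 ≤ B) (hκE : κ ≤ κE)
    (hLsec : ∀ (K k : ℕ) (i : Fin (k + 1)), ∀ g ∈ box θ.γ k, ∀ (X : (domSys (F.P K) M (k + 1)).Dom), ∀ φ ∈ sp K k X,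
      ∃ (Ec : ℂ → ℂ) (O : Set ℂ) (Vc : ℂ), DifferentiableOn ℂ Ec O ∧ (∀ s ∈ Ioc (0 : ℝ) θ.γ, closedBall (s : ℂ) (c * s) ⊆ O) ∧
        (∀ s ∈ Ioc (0 : ℝ) θ.γ, ∀ z ∈ closedBall (s : ℂ) (c * s), ‖Ec z - Vc‖ ≤ B'' * q ^ (k - (i : ℕ)) * Real.exp (-(κE * (domSys (F.P K) M (k + 1)).dj X)) * s ^ 2) ∧
        (∀ t ∈ Ioc (0 : ℝ) θ.γ, Ec t = ((S K) k).E (Function.update g i t) φ X))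
    (hbd : ∀ g ∈ Window θ.γ, ∀ (K k : ℕ) (X : (domSys (F.P K) M (k + 1)).Dom), ∀ φ ∈ sp K k X,
      ‖((S K) k).E (histPrefix g k) φ X‖ ≤ B * Real.exp (-(κE * (domSys (F.P K) M (k + 1)).dj X)))
    (Ec : ℕ → ℕ → Type*) [∀ K k, NormedAddCommGroup (Ec K k)] [∀ K k, NormedSpace ℂ (Ec K k)]
    (ι : letI := θ.instVβ₁; letI := θ.instVβ₂
      (K k : ℕ) → (domSys (F.P K) M (k + 1)).Dom → ((Fin (F.P K).d → Site (F.P K) (k + 1) → θ.Vβ) →L[ℝ] Ec K k))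
    (Φ : (K k : ℕ) → (domSys (F.P K) M (k + 1)).Dom → Ec K k → CPair (F.P K) 𝔸)
    (U : (K k : ℕ) → (domSys (F.P K) M (k + 1)).Dom → Set (Ec K k)) (hU : ∀ K k X, IsOpen (U K k X)) (hrU : ∀ K k X, ball (0 : Ec K k) r ⊆ U K k X)
    (hEhol : ∀ g ∈ Window θ.γ, ∀ (K k : ℕ) (X : (domSys (F.P K) M (k + 1)).Dom),
      DifferentiableOn ℂ (fun z => ((S K) k).E (histPrefix g k) (Φ K k X z) X) (U K k X))
    (hΦemb : letI := θ.instVβ₁; letI := θ.instVβ₂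
      ∀ (K k : ℕ) (X : (domSys (F.P K) M (k + 1)).Dom) (Bf : Fin (F.P K).d → Site (F.P K) (k + 1) → θ.Vβ),
        Φ K k X (ι K k X Bf) = emb K k (fun l t => NormedSpace.exp (θ.ρ8 (Bf l t))))
    (hΦsp : ∀ (K k : ℕ) (X : (domSys (F.P K) M (k + 1)).Dom), ∀ z ∈ ball (0 : Ec K k) r, Φ K k X z ∈ sp K k X)
    (w : (K k : ℕ) → (domSys (F.P K) M (k + 1)).Dom → Site (F.P K) (k + 1) → ℝ) (hw₀ : ∀ K k X t, 0 ≤ w K k X t)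
    (hw : letI := θ.instVβ₁; letI := θ.instVβ₂; letI := θ.instιβ
      ∀ (K k : ℕ) (X : (domSys (F.P K) M (k + 1)).Dom) (l : Fin (F.P K).d) (t : Site (F.P K) (k + 1)) (c : θ.ιβ),
        ‖ι K k X (Pi.single l (Pi.single t (θ.bV c)))‖ ≤ w K k X t)
    (htail : ∀ (K k : ℕ) (X : (domSys (F.P K) M (k + 1)).Dom) (t : Site (F.P K) (k + 1)),
      let e : Site (F.P K) (k + 1) → TPt 4 (domCount (F.P K) M (k + 1) * M) := fun x i => (ZMod.cast (x i) : ZMod (domCount (F.P K) M (k + 1) * M))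
      w K k X t ≤ B₃ * Real.exp (-δ₀ * distCT (domCount (F.P K) M (k + 1)) M (e t) (nearT (M := M) (e t) X)))
    (hκ₅ : delta1 δ₀ κ ((M : ℝ) * 4) ≤ κ₅)
    (hω : 0 < ℓ.ω) (hθω : ℓ.θ₅ * q ≤ ℓ.ω ^ 2) (hℓκ : ℓ.κ ≤ delta1 δ₀ κ ((M : ℝ) * 4))
    (hC₉ : (4 * (2 * C₅ / (1 - ℓ.θ₅) + 2 * ((16 * B * B₃ ^ 2 / r ^ 2) * Real.exp (delta1 δ₀ κ ((M : ℝ) * 4) * ((M : ℝ) * 4) * 3) * K₀ (4 * 2 ^ 4) (2 * 4) * K₁ 4 (δ₀ / 2))) / θ.γ +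
        ((16 * ((6 * c ^ 2 + 32 * c + 64) / c ^ 2 * B'') * B₃ ^ 2 / r ^ 2) * Real.exp (delta1 δ₀ κ ((M : ℝ) * 4) * ((M : ℝ) * 4) * 3) * K₀ (4 * 2 ^ 4) (2 * 4) *
          K₁ 4 (δ₀ / 2)) * θ.γ / 2) / ℓ.ω ≤ ℓ.C₉) (k : ℕ) :
    N22At (rateCarriersOfRecord₁₃CoPH 𝔯 F θ hP g₀ os k).u3 :=
  n22At_rateCarriers_of_kernels_pin_of_ne9 𝔯 θ hP g₀ os ℓ hs hpin
    (ne9_EA_objectsOfRecord₁₃_of_kernelStepRate_sectorHoloGrowing F N θ.toStage13Params ℓ hs hγ hlim hC₅ h5 m' M hM S emb hloc sp hc hB'' hq hκ₀ hδ₀ hB₃ hr hB hκE hLsec hbd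
      Ec ι Φ U hU hrU hEhol hΦemb hΦsp w hw₀ hw htail hκ₅ hω hθω hℓκ hC₉) k

end YMDAG.N22.KernelFading

end
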